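import Mathlib

/-!
# SoloBlind — thickened nilpotency at a non-logarithmic fixed component (paper §18.1, Theorem T′), `p = 3`

Context (solo-blind programme on `ResolutionOfSingularities`, W-side, point dynamics `N₃`).  Let `σ` be an
automorphism of order `p` of a ring `A` of characteristic `p`, `u ∈ A` a non-zero-divisor and suppose
`δ := σ − 1` satisfies `δ(A) ⊆ u^m A` (a fixed component `{u = 0}` of multiplicity `m`), and write
`δ = u^m L`.  When `p ∣ m` — the regime the canonical blow-up tree of §17.4 enters at its fifth step (a bare,
non-logarithmic component of multiplicity `6` in characteristic `3`) — the operator `L` preserves `u^m A`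
and induces a DERIVATION `Δ` of `A/(u^m)` (it need not preserve the ideal `(u)`: the component is
non-logarithmic).  Theorem T′ of the paper: `Δ^p = 0`, i.e. `L^p(A) ⊆ u^m A`
(telescoping `0 = u^{-pm} δ^p = ∏ₖ (L + cₖ σ)` with `cₖ = u^{-(k+1)m} δ(u^{km}) ∈ u^m A`, which uses
`(σ u)^m ≡ u^m (mod u^{3m})`, a consequence of `p ∣ m` and Frobenius).

This file lands the case `p = 3` as a sorry-free ring statement.  Hypotheses: `3 = 0` in `A`,
`σ : A →+* A` with `σ ∘ σ ∘ σ = id`, `3 ∣ m`, and a map `L` with `σ a = a + u^m · L a` for all `a`.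
Conclusion: `(u^m)^3 · (L (L (L a)) − u^m · g) = 0` for an explicit `g`, hence `L³ a ∈ u^m A` when `u` is a
non-zero-divisor.  The residual linear map `N` of the residual field at any point of such a component is
therefore nilpotent (`N^3 = 0`): no residual zero on a bare component with `3 ∣ m` is a good (multiplicative)
point — the content of Corollary 18.2.
-/

namespace Summit.ResolutionOfSingularities.ResolutionOfSingularities.Theorems.SoloBlind

variable {A : Type*} [CommRing A]

/-- In characteristic `3`, cubing is additive. -/
theorem cube_add_of_three_eq_zero (h3 : (3 : A) = 0) (x y : A) :
    (x + y) ^ 3 = x ^ 3 + y ^ 3 := by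
  linear_combination (x ^ 2 * y + x * y ^ 2) * h3

/-- Frobenius step: if `3 ∣ m` then `(u + u^m c)^m ≡ u^m (mod u^{3m})` in characteristic `3`. -/
theorem pow_add_pow_mul_of_three_dvd (h3 : (3 : A) = 0) (u c : A) {m : ℕ} (hm : 3 ∣ m) :
    ∃ e : A, (u + u ^ m * c) ^ m = u ^ m + (u ^ m) ^ 3 * e := by
  obtain ⟨n, rfl⟩ := hm
  have hcube : (u + u ^ (3 * n) * c) ^ 3 = u ^ 3 + (u ^ (3 * n)) ^ 3 * c ^ 3 := by
    rw [cube_add_of_three_eq_zero h3]; ring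
  obtain ⟨q, hq⟩ := sub_dvd_pow_sub_pow (u ^ 3 + (u ^ (3 * n)) ^ 3 * c ^ 3) (u ^ 3) n
  refine ⟨c ^ 3 * q, ?_⟩
  have h33 : (u ^ 3) ^ n = u ^ (3 * n) := (pow_mul u 3 n).symm
  rw [pow_mul, hcube, ← h33]
  rw [h33] at hq ⊢
  linear_combination hq

/-- **Theorem T′ for `p = 3`** (thickened nilpotency, paper §18.1).  If `3 = 0` in `A`, `σ³ = id`,
`3 ∣ m` and `σ a = a + u^m · L a` for every `a`, then `(u^m)^3 · (L³ a − u^m g) = 0` for some `g`. -/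
theorem thickened_nilpotency_three (h3 : (3 : A) = 0) (σ : A →+* A) (hσ : ∀ a, σ (σ (σ a)) = a)
    (u : A) {m : ℕ} (hm : 3 ∣ m) (L : A → A) (hL : ∀ a, σ a = a + u ^ m * L a) (a : A) :
    ∃ g : A, (u ^ m) ^ 3 * (L (L (L a)) - u ^ m * g) = 0 := by
  obtain ⟨e₁, he₁⟩ := pow_add_pow_mul_of_three_dvd h3 u (L u) hm
  have hU : σ u ^ m = u ^ m + (u ^ m) ^ 3 * e₁ := by rw [hL u, he₁]
  have ha := hL a
  have ha1 := hL (L a)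
  have ha2 := hL (L (L a))
  have he := hL e₁
  have key := hσ a
  simp only [ha, map_add, map_mul, map_pow, hU, ha1, ha2, he] at key
  refine ⟨(-1) * L a * L e₁ + u ^ m * L (L a) * L e₁ + (-1) * (u ^ m) ^ 2 * L (L (L a)) * L e₁
      + (u ^ m) ^ 2 * L (L a) * e₁ ^ 2 + (u ^ m) ^ 3 * L (L (L a)) * e₁ ^ 2
      + (-1) * (u ^ m) ^ 3 * L (L a) * e₁ * L e₁ + (-1) * (u ^ m) ^ 4 * L (L (L a)) * e₁ * L e₁
      + (-1) * (u ^ m) ^ 5 * L a * e₁ ^ 4 + (u ^ m) ^ 6 * L (L a) * e₁ ^ 4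
      + (-1) * (u ^ m) ^ 6 * L a * e₁ ^ 3 * L e₁ + (-1) * (u ^ m) ^ 7 * L (L (L a)) * e₁ ^ 4
      + (u ^ m) ^ 7 * L (L a) * e₁ ^ 3 * L e₁ + (-1) * (u ^ m) ^ 8 * L (L (L a)) * e₁ ^ 3 * L e₁
      + (-1) * (u ^ m) ^ 8 * L (L a) * e₁ ^ 5 + (-1) * (u ^ m) ^ 9 * L (L (L a)) * e₁ ^ 5
      + (-1) * (u ^ m) ^ 9 * L (L a) * e₁ ^ 4 * L e₁ + (-1) * (u ^ m) ^ 10 * L (L (L a)) * e₁ ^ 4 * L e₁, ?_⟩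
  linear_combination key
    + ((-1) * u ^ m * L a + (-1) * (u ^ m) ^ 2 * L (L a) + (-1) * (u ^ m) ^ 3 * L a * e₁
      + (-2) * (u ^ m) ^ 4 * L (L a) * e₁ + (-1) * (u ^ m) ^ 5 * L (L (L a)) * e₁
      + (-1) * (u ^ m) ^ 5 * L (L a) * L e₁ + (-1) * (u ^ m) ^ 5 * L a * e₁ ^ 2
      + (-3) * (u ^ m) ^ 6 * L (L a) * e₁ ^ 2 + (-1) * (u ^ m) ^ 6 * L a * e₁ * L e₁
      + (-2) * (u ^ m) ^ 7 * L (L (L a)) * e₁ ^ 2 + (-2) * (u ^ m) ^ 7 * L (L a) * e₁ * L e₁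
      + (-1) * (u ^ m) ^ 7 * L a * e₁ ^ 3 + (-1) * (u ^ m) ^ 8 * L (L (L a)) * e₁ * L e₁
      + (-3) * (u ^ m) ^ 8 * L (L a) * e₁ ^ 3 + (-1) * (u ^ m) ^ 8 * L a * e₁ ^ 2 * L e₁
      + (-2) * (u ^ m) ^ 9 * L (L (L a)) * e₁ ^ 3 + (-3) * (u ^ m) ^ 9 * L (L a) * e₁ ^ 2 * L e₁
      + (-2) * (u ^ m) ^ 10 * L (L (L a)) * e₁ ^ 2 * L e₁ + (-2) * (u ^ m) ^ 10 * L (L a) * e₁ ^ 4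
      + (-1) * (u ^ m) ^ 11 * L (L (L a)) * e₁ ^ 4 + (-2) * (u ^ m) ^ 11 * L (L a) * e₁ ^ 3 * L e₁
      + (-1) * (u ^ m) ^ 12 * L (L (L a)) * e₁ ^ 3 * L e₁) * h3

/-- **Corollary (`L³(A) ⊆ u^m A`).**  Under the hypotheses of `thickened_nilpotency_three`, if `u` is a
non-zero-divisor then `L (L (L a)) ∈ u^m A`: the derivation induced by `L` on `A/(u^m)` is `3`-nilpotent. -/
theorem thickened_nilpotency_three_of_mem_nonZeroDivisors (h3 : (3 : A) = 0) (σ : A →+* A)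
    (hσ : ∀ a, σ (σ (σ a)) = a) (u : A) (hu : u ∈ nonZeroDivisors A) {m : ℕ} (hm : 3 ∣ m)
    (L : A → A) (hL : ∀ a, σ a = a + u ^ m * L a) (a : A) :
    ∃ g : A, L (L (L a)) = u ^ m * g := by
  obtain ⟨g, hg⟩ := thickened_nilpotency_three h3 σ hσ u hm L hL a
  refine ⟨g, ?_⟩
  have hU3 : (u ^ m) ^ 3 ∈ nonZeroDivisors A := pow_mem (pow_mem hu m) 3
  exact sub_eq_zero.mp ((mem_nonZeroDivisors_iff.mp hU3).1 _ hg)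

/-- The hypothesis `σ a = a + u^m · L a` makes `L` additive modulo `u`-torsion; on a non-zero-divisor `u`
it is literally additive.  (Recorded for the paper's use of `Δ` as a derivation; Leibniz is
`L (a b) = L a · b + a · L b + u^m · L a · L b`.) -/
theorem twisted_leibniz_of_shift (σ : A →+* A) (u : A) {m : ℕ} (L : A → A)
    (hL : ∀ a, σ a = a + u ^ m * L a) (a b : A) :
    u ^ m * L (a * b) = u ^ m * (L a * b + a * L b + u ^ m * (L a * L b)) := by
  have h := map_mul σ a b
  rw [hL (a * b), hL a, hL b] at h
  linear_combination h

end Summit.ResolutionOfSingularities.ResolutionOfSingularities.Theorems.SoloBlind
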